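import Mathlib
import HarnessLib
import Literature.NumberTheory.LFunctions.RHWave0

/-!
# The Redheffer matrix and `det Aₙ = M(n)`

R. Redheffer (1977) introduced the `n × n` `(0,1)`-matrix `Aₙ = (a_{ij})_{1 ≤ i,j ≤ n}` with
`a_{ij} = 1` if `j = 1` or `i ∣ j`, and `a_{ij} = 0` otherwise, and observed that its determinant
is the Mertens function: `det Aₙ = M(n) = ∑_{k ≤ n} μ(k)`.  Consequently (Littlewood) the Riemann
Hypothesis is equivalent to `det Aₙ = O(n^{1/2+ε})` for every `ε > 0`
(Barrett–Forcade–Pollington 1988); this file proves ONLY the finite identity and its immediate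
finite-level consequences for the Gram form `Aₙᵀ Aₙ` — no statement about RH is made or used.

## Main statements (all PROVED; the file introduces no named facts; the factor `Pₙ` and the
reindexing lemmas of the proof are `private`)

* `Redheffer.redheffer n : Matrix (Fin n) (Fin n) ℤ` — the matrix; the index `i : Fin n` stands
  for the integer `i + 1 ∈ {1, …, n}`.
* `Redheffer.det_redheffer` — `det Aₙ = ∑_{k ∈ (0,n]} μ(k)` for `n ≠ 0`
  (for `n = 0` the empty determinant is `1 = Matrix.det_isEmpty` whereas `M(0) = 0`, so the
  hypothesis is necessary).
* `Redheffer.det_redheffer_eq_mertensFunction` — the same in the tree's vocabulary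
  `Literature.NumberTheory.LFunctions.mertensFunction` (`RHWave0.lean`).
* `Redheffer.exists_mulVec_eq_zero_iff` — `Aₙ` is singular iff `M(n) = 0`.
* `Redheffer.det_transpose_mul_self`, `Redheffer.posSemidef_transpose_mul_self`,
  `Redheffer.posDef_transpose_mul_self_iff` — the Gram form `Aₙᵀ Aₙ` has determinant `M(n)²`,
  is positive semidefinite, and is positive definite iff `M(n) ≠ 0`.

## Proof

We follow the factorisation proof (Redheffer 1977; Barrett–Forcade–Pollington 1988, §1;
Robinson–Barrett 1989, p. 58, who phrase it with `Dₙ⁻¹ = (μ(j/i)[i ∣ j])`): `Aₙ = Dₙ · Pₙ`,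
where `Dₙ = ([i ∣ j])` is the upper unitriangular divisibility matrix and `Pₙ` is the identity
matrix with its first column replaced by `(M(⌊n/1⌋), M(⌊n/2⌋), …, M(⌊n/n⌋))ᵀ`.  The only
arithmetic input is the entry `(Dₙ Pₙ)_{i,1} = ∑_{d ≤ n/i} M(⌊n/(id)⌋) = 1`, i.e. the classical
identity `∑_{d ≤ N} M(⌊N/d⌋) = 1` (`N ≥ 1`), which is `ζ * μ = 1` summed over `(0, N]`
(Mathlib's `ArithmeticFunction.sum_Ioc_mul_eq_sum_sum` and `coe_zeta_mul_moebius`).  Hence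
`det Aₙ = det Dₙ · det Pₙ = 1 · M(n)` by `Matrix.det_of_upperTriangular` /
`Matrix.det_of_lowerTriangular`.

## References

* [Redheffer1977] R. Redheffer, *Eine explizit lösbare Optimierungsaufgabe*, in: Numerische
  Methoden bei Optimierungsaufgaben, Band 3, ISNM 36, Birkhäuser (1977), 213–216 — the matrix and
  `det Aₙ = M(n)` (cited through the two sources below).
* [RobinsonBarrett1989] D. W. Robinson, W. W. Barrett, *The Jordan 1-structure of a matrix of
  Redheffer*, Linear Algebra Appl. 112 (1989) 57–73, p. 58: "the determinant of `Aₙ` is Mertens's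
  function `M(n) = ∑_{k=1}^{n} μ(k)`" (read at page).
* [ClementSteinerberger2025] F. Clément, S. Steinerberger, *On the largest singular vector of the
  Redheffer matrix*, arXiv:2502.09489 = Linear Algebra Appl. (2025), §1.1: the definition,
  `det(Aₙ) = ∑_{k=1}^{n} μ(k)`, and the Gram matrix `Aₙᵀ Aₙ` (read at page).

## Mathlib / tree search

Mathlib has no Redheffer matrix (`lean search Redheffer`: no hits in Mathlib + tree, 2026-08-20).
Used: `Matrix.det_of_upperTriangular`, `Matrix.det_of_lowerTriangular`, `Matrix.det_mul`,
`ArithmeticFunction.sum_Ioc_mul_eq_sum_sum`, `ArithmeticFunction.coe_zeta_mul_moebius`,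
`Matrix.posSemidef_conjTranspose_mul_self`, `Matrix.exists_mulVec_eq_zero_iff`,
`Matrix.dotProduct_star_self_pos_iff`; tree: `Literature.NumberTheory.LFunctions.mertensFunction`.
-/

open Finset Matrix
open scoped ArithmeticFunction.Moebius

namespace Literature.NumberTheory.Multiplicative

namespace Redheffer

/-! ## The matrices -/

/-- **Redheffer's matrix** `Aₙ ∈ Mₙ(ℤ)`: rows and columns are indexed by `Fin n`, the index `i`
standing for the integer `i + 1 ∈ {1, …, n}`; the entry at `(i, j)` is `1` if the column integer
`j + 1` equals `1` or the row integer `i + 1` divides `j + 1`, and `0` otherwise.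
[cite: ClementSteinerberger2025, §1.1] -/
def redheffer (n : ℕ) : Matrix (Fin n) (Fin n) ℤ :=
  Matrix.of fun i j : Fin n => if (j : ℕ) = 0 ∨ (i : ℕ) + 1 ∣ (j : ℕ) + 1 then (1 : ℤ) else 0

/-- Entry formula for `redheffer`. [cite: ClementSteinerberger2025, §1.1] -/
theorem redheffer_apply (n : ℕ) (i j : Fin n) :
    redheffer n i j = if (j : ℕ) = 0 ∨ (i : ℕ) + 1 ∣ (j : ℕ) + 1 then (1 : ℤ) else 0 := rfl

/-- The divisibility matrix `Dₙ = ([i ∣ j])_{1 ≤ i, j ≤ n}` (same indexing convention as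
`redheffer`). [cite: RobinsonBarrett1989, p. 57] -/
def divisibility (n : ℕ) : Matrix (Fin n) (Fin n) ℤ :=
  Matrix.of fun i j : Fin n => if (i : ℕ) + 1 ∣ (j : ℕ) + 1 then (1 : ℤ) else 0

/-- Entry formula for `divisibility`. [cite: RobinsonBarrett1989, p. 57] -/
theorem divisibility_apply (n : ℕ) (i j : Fin n) :
    divisibility n i j = if (i : ℕ) + 1 ∣ (j : ℕ) + 1 then (1 : ℤ) else 0 := rfl

/-- The lower-triangular factor `Pₙ`: the identity matrix with its first column replaced by
`i ↦ M(⌊n/i⌋) = ∑_{m ≤ n/i} μ(m)`. [folklore] -/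
private def mertensFactor (n : ℕ) : Matrix (Fin n) (Fin n) ℤ :=
  Matrix.of fun i j : Fin n =>
    if (j : ℕ) = 0 then ∑ m ∈ Ioc 0 (n / ((i : ℕ) + 1)), μ m else if i = j then 1 else 0

/-- Entry formula for `mertensFactor`. [folklore] -/
private theorem mertensFactor_apply (n : ℕ) (i j : Fin n) :
    mertensFactor n i j =
      if (j : ℕ) = 0 then ∑ m ∈ Ioc 0 (n / ((i : ℕ) + 1)), μ m else if i = j then 1 else 0 :=
  rfl

/-! ## Two reindexing lemmas and the Möbius identity `∑_{d ≤ N} M(⌊N/d⌋) = 1` -/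

/-- Reindexing a sum over `Fin n` by `k ↦ k + 1 ∈ (0, n]`. [folklore] -/
private theorem sum_fin_eq_sum_Ioc {M : Type*} [AddCommMonoid M] (n : ℕ) (F : ℕ → M) :
    ∑ k : Fin n, F ((k : ℕ) + 1) = ∑ m ∈ Ioc 0 n, F m := by
  refine Finset.sum_bij' (fun k _ => (k : ℕ) + 1)
    (fun m hm => ⟨m - 1, by have := Finset.mem_Ioc.1 hm; omega⟩) ?_ ?_ ?_ ?_ ?_
  · intro k _
    exact Finset.mem_Ioc.2 ⟨Nat.succ_pos _, k.2⟩
  · intro m _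
    exact Finset.mem_univ _
  · intro k _
    ext
    simp
  · intro m hm
    have := Finset.mem_Ioc.1 hm
    simp only
    omega
  · intro k _
    rfl

/-- `∑_{m ≤ n, a ∣ m} g(m) = ∑_{d ≤ n/a} g(a d)` for `a ≥ 1`. [folklore] -/
private theorem sum_Ioc_filter_dvd_eq_sum {M : Type*} [AddCommMonoid M] {a : ℕ} (ha : 0 < a) (n : ℕ)
    (g : ℕ → M) :
    ∑ m ∈ (Ioc 0 n).filter (fun m => a ∣ m), g m = ∑ d ∈ Ioc 0 (n / a), g (a * d) := by
  refine Finset.sum_bij' (fun m _ => m / a) (fun d _ => a * d) ?_ ?_ ?_ ?_ ?_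
  · intro m hm
    rw [Finset.mem_filter, Finset.mem_Ioc] at hm
    obtain ⟨⟨h1, h2⟩, h3⟩ := hm
    exact Finset.mem_Ioc.2 ⟨Nat.div_pos (Nat.le_of_dvd h1 h3) ha, Nat.div_le_div_right h2⟩
  · intro d hd
    obtain ⟨h1, h2⟩ := Finset.mem_Ioc.1 hd
    rw [Finset.mem_filter, Finset.mem_Ioc]
    refine ⟨⟨Nat.mul_pos ha h1, ?_⟩, dvd_mul_right a d⟩
    rw [mul_comm]
    exact (Nat.le_div_iff_mul_le ha).1 h2
  · intro m hm
    rw [Finset.mem_filter] at hm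
    exact Nat.mul_div_cancel' hm.2
  · intro d _
    exact Nat.mul_div_cancel_left d ha
  · intro m hm
    rw [Finset.mem_filter] at hm
    rw [Nat.mul_div_cancel' hm.2]

/-- The classical identity `∑_{d ≤ N} M(⌊N/d⌋) = 1` for `N ≥ 1` (`ζ * μ = 1` summed over
`(0, N]`). [folklore] -/
private theorem sum_sum_moebius_div_eq_one {N : ℕ} (hN : 0 < N) :
    ∑ d ∈ Ioc 0 N, ∑ m ∈ Ioc 0 (N / d), μ m = 1 := by
  have h := ArithmeticFunction.sum_Ioc_mul_eq_sum_sum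
    (ArithmeticFunction.zeta : ArithmeticFunction ℤ) (μ : ArithmeticFunction ℤ) N
  rw [ArithmeticFunction.coe_zeta_mul_moebius] at h
  have h1 : ∑ n ∈ Ioc 0 N, (1 : ArithmeticFunction ℤ) n = 1 := by
    rw [Finset.sum_eq_single_of_mem 1 (Finset.mem_Ioc.2 ⟨Nat.one_pos, hN⟩)]
    · simp
    · intro b _ hb
      simp [hb]
  rw [h1] at h
  rw [h]
  refine Finset.sum_congr rfl fun d hd => ?_
  have hd0 : d ≠ 0 := (Finset.mem_Ioc.1 hd).1.ne'
  rw [ArithmeticFunction.natCoe_apply, ArithmeticFunction.zeta_apply, if_neg hd0, Nat.cast_one,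
    one_mul]

/-! ## The factorisation `Aₙ = Dₙ Pₙ` and the three determinants -/

/-- The first-column entries of `Dₙ Pₙ`: `∑_{k ≤ n, i ∣ k} M(⌊n/k⌋) = 1` for `1 ≤ i ≤ n`.
[folklore] -/
private theorem sum_divisibility_mul_mertens (n : ℕ) (i : Fin n) :
    ∑ k : Fin n, (if (i : ℕ) + 1 ∣ (k : ℕ) + 1 then (1 : ℤ) else 0) *
        ∑ m ∈ Ioc 0 (n / ((k : ℕ) + 1)), μ m = 1 := by
  have ha : 0 < (i : ℕ) + 1 := Nat.succ_pos _
  have han : (i : ℕ) + 1 ≤ n := Nat.succ_le_of_lt i.is_lt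
  have step1 : ∀ k : Fin n, (if (i : ℕ) + 1 ∣ (k : ℕ) + 1 then (1 : ℤ) else 0) *
      ∑ m ∈ Ioc 0 (n / ((k : ℕ) + 1)), μ m =
      (fun x : ℕ => if (i : ℕ) + 1 ∣ x then ∑ m ∈ Ioc 0 (n / x), μ m else 0) ((k : ℕ) + 1) := by
    intro k
    simp only [ite_mul, one_mul, zero_mul]
  rw [Finset.sum_congr rfl fun k _ => step1 k,
    sum_fin_eq_sum_Ioc n (fun x : ℕ => if (i : ℕ) + 1 ∣ x then ∑ m ∈ Ioc 0 (n / x), μ m else 0),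
    ← Finset.sum_filter,
    sum_Ioc_filter_dvd_eq_sum ha n]
  have step2 : ∀ d : ℕ, n / (((i : ℕ) + 1) * d) = n / ((i : ℕ) + 1) / d := fun d =>
    (Nat.div_div_eq_div_mul n ((i : ℕ) + 1) d).symm
  simp only [step2]
  exact sum_sum_moebius_div_eq_one (Nat.div_pos han ha)

/-- **Factorisation** `Dₙ · Pₙ = Aₙ`. [folklore] -/
private theorem divisibility_mul_mertensFactor (n : ℕ) :
    divisibility n * mertensFactor n = redheffer n := by
  ext i j
  rw [Matrix.mul_apply, redheffer_apply]
  by_cases hj : (j : ℕ) = 0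
  · simp only [divisibility_apply, mertensFactor_apply, hj, true_or, if_true]
    exact sum_divisibility_mul_mertens n i
  · simp only [divisibility_apply, mertensFactor_apply, hj, false_or, if_false, mul_ite, mul_one,
      mul_zero, Finset.sum_ite_eq', Finset.mem_univ, if_true]

/-- `Dₙ` is upper unitriangular (`i ∣ j ⇒ i ≤ j`), so `det Dₙ = 1`. [folklore] -/
private theorem det_divisibility (n : ℕ) : (divisibility n).det = 1 := by
  have hT : (divisibility n).BlockTriangular id := by
    intro i j hij
    have h1 : (j : ℕ) < (i : ℕ) := hij
    rw [divisibility_apply]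
    apply if_neg
    intro hdvd
    have := Nat.le_of_dvd (Nat.succ_pos _) hdvd
    omega
  rw [Matrix.det_of_upperTriangular hT]
  refine Finset.prod_eq_one fun i _ => ?_
  simp [divisibility_apply]

/-- `Pₙ` is lower triangular with diagonal `(M(n), 1, …, 1)`, so `det Pₙ = M(n)` (`n ≥ 1`).
[folklore] -/
private theorem det_mertensFactor {n : ℕ} (hn : n ≠ 0) :
    (mertensFactor n).det = ∑ m ∈ Ioc 0 n, μ m := by
  obtain ⟨k, rfl⟩ : ∃ k, n = k + 1 := ⟨n - 1, by omega⟩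
  have hT : (mertensFactor (k + 1)).BlockTriangular OrderDual.toDual := by
    intro i j hij
    have h1 : i < j := OrderDual.toDual_lt_toDual.1 hij
    have h2 : (i : ℕ) < (j : ℕ) := Fin.lt_def.1 h1
    have hj : (j : ℕ) ≠ 0 := by omega
    have hij' : i ≠ j := ne_of_lt h1
    simp [mertensFactor_apply, hj, hij']
  rw [Matrix.det_of_lowerTriangular _ hT, Fintype.prod_eq_single (0 : Fin (k + 1))]
  · simp [mertensFactor_apply]
  · intro i hi
    have : (i : ℕ) ≠ 0 := fun h => hi (Fin.ext h)
    simp [mertensFactor_apply, this]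

/-! ## Redheffer's determinant -/

/-- **Redheffer's determinant formula**: `det Aₙ = ∑_{1 ≤ k ≤ n} μ(k) = M(n)` for `n ≥ 1`.
[cite: Redheffer1977, p. 213; RobinsonBarrett1989, p. 58; ClementSteinerberger2025, §1.1] -/
theorem det_redheffer {n : ℕ} (hn : n ≠ 0) : (redheffer n).det = ∑ k ∈ Ioc 0 n, μ k := by
  rw [← divisibility_mul_mertensFactor, Matrix.det_mul, det_divisibility, one_mul,
    det_mertensFactor hn]

/-- **Redheffer's determinant formula** in the tree's vocabulary: `det Aₙ = M(n)` with
`M = Literature.NumberTheory.LFunctions.mertensFunction`, `n ≥ 1`.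
[cite: Redheffer1977, p. 213; RobinsonBarrett1989, p. 58] -/
theorem det_redheffer_eq_mertensFunction {n : ℕ} (hn : n ≠ 0) :
    (redheffer n).det = LFunctions.mertensFunction (n : ℝ) := by
  rw [det_redheffer hn, LFunctions.mertensFunction, Nat.floor_natCast]

/-- `Aₙ` is singular (has a nonzero integer kernel vector) iff `M(n) = 0` (`n ≥ 1`).
[cite: ClementSteinerberger2025, §1.1] -/
theorem exists_mulVec_eq_zero_iff {n : ℕ} (hn : n ≠ 0) :
    (∃ v ≠ 0, redheffer n *ᵥ v = 0) ↔ ∑ k ∈ Ioc 0 n, μ k = 0 := by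
  rw [Matrix.exists_mulVec_eq_zero_iff, det_redheffer hn]

/-! ## The Gram form `Aₙᵀ Aₙ` -/

/-- `det(Aₙᵀ Aₙ) = M(n)²` (`n ≥ 1`). [cite: ClementSteinerberger2025, §1.1] -/
theorem det_transpose_mul_self {n : ℕ} (hn : n ≠ 0) :
    ((redheffer n)ᵀ * redheffer n).det = (∑ k ∈ Ioc 0 n, μ k) ^ 2 := by
  rw [Matrix.det_mul, Matrix.det_transpose, det_redheffer hn, sq]

/-- The Gram form `Aₙᵀ Aₙ` is positive semidefinite (for every `n`).
[cite: ClementSteinerberger2025, §1.1] -/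
theorem posSemidef_transpose_mul_self (n : ℕ) : ((redheffer n)ᵀ * redheffer n).PosSemidef := by
  have h := Matrix.posSemidef_conjTranspose_mul_self (redheffer n)
  rwa [Matrix.conjTranspose_eq_transpose_of_trivial] at h

/-- The Gram form `Aₙᵀ Aₙ` is positive definite iff `M(n) ≠ 0` (`n ≥ 1`): over `ℤ`,
`xᵀ Aₙᵀ Aₙ x = ‖Aₙ x‖² > 0` for all `x ≠ 0` iff `Aₙ` has trivial kernel iff `det Aₙ ≠ 0`.
[cite: ClementSteinerberger2025, §1.1] -/
theorem posDef_transpose_mul_self_iff {n : ℕ} (hn : n ≠ 0) :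
    ((redheffer n)ᵀ * redheffer n).PosDef ↔ ∑ k ∈ Ioc 0 n, μ k ≠ 0 := by
  rw [← det_redheffer hn, Matrix.posDef_iff_dotProduct_mulVec]
  have hH : ((redheffer n)ᵀ * redheffer n).IsHermitian := (posSemidef_transpose_mul_self n).1
  have hq : ∀ x : Fin n → ℤ, star x ⬝ᵥ (((redheffer n)ᵀ * redheffer n) *ᵥ x) =
      star (redheffer n *ᵥ x) ⬝ᵥ (redheffer n *ᵥ x) := by
    intro x
    simp only [star_trivial]
    rw [← Matrix.mulVec_mulVec, Matrix.dotProduct_mulVec, Matrix.vecMul_transpose]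
  constructor
  · rintro ⟨-, hpos⟩ hdet
    obtain ⟨v, hv0, hv⟩ := Matrix.exists_mulVec_eq_zero_iff.2 hdet
    have := hpos hv0
    rw [hq, hv] at this
    simp at this
  · intro hdet
    refine ⟨hH, fun x hx => ?_⟩
    rw [hq, Matrix.dotProduct_star_self_pos_iff]
    intro h0
    exact hdet (Matrix.exists_mulVec_eq_zero_iff.1 ⟨x, hx, h0⟩)

end Redheffer

end Literature.NumberTheory.Multiplicative
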